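import Mathlib
import Literature.Analysis.FluidPDE.ClassicalSolution
import Literature.Analysis.FluidPDE.LerayHopf
import Literature.Analysis.FluidPDE.NSWave0
import Literature.Analysis.FluidPDE.NSCriticalClosureBesovBounded
import Literature.Analysis.FluidPDE.TaoLocalisationHolds
import Summits.NavierStokesRegularity.NavierStokesRegularity.Theses.L3TimeExponentPincer
import Summits.NavierStokesRegularity.NavierStokesRegularity.Theorems.L3TimeExponentPincerSmoothBranch
import Summits.NavierStokesRegularity.NavierStokesRegularity.Theorems.L3TimeExponentPincerJawNormalForm
import HarnessLib

/-!
# Crux `L3CascadeJaw` (stmt-NavierStokesRegularity-19499): the final window is decoration —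
# the clause is integrability on the WHOLE interval `(0,T)`

Support file for the PARENT crux `L3CascadeJaw` of route `L3TimeExponentPincer` (cell
ns-regularity-ideate, seat ns-pincer-19499-p1).  The crux asks `∃ T₂ ∈ (0,T)` with
`∫_{T₂}^T ‖u(t)‖₃^q dt < ∞`.  For a frame solution the integrand is BOUNDED on every closed sub-slab
`[0,T₁]`, `T₁ < T` (Tao 2013: a classical finite-energy solution from a Schwartz datum has
`sup_{[0,T₁]×ℝ³} |u| ≤ M`, tree theorem `exists_forall_norm_le_of_tao2011` with the discharged
`tao2011_hasBoundedSobolevNormsOn_holds`; then `‖u(t)‖₃³ ≤ M · 2E(u₀)`), so only the germ at `T` matters: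

* `lintegral_l3_rpow_Ioc_lt_top_of_frame` — `∫_{(0,T₁]} ‖u(t)‖₃^q dt < ∞` for every `T₁ < T`, `q ≥ 0`;
* `lintegral_whole_lt_top_of_window` — a finite final window gives `∫₀ᵀ ‖u(t)‖₃^q dt < ∞`;
* `jawClause_iff_whole_interval` — `(∃ T₂ ∈ (0,T), ∫_{T₂}^T ‖u‖₃^q < ∞) ↔ ∫₀ᵀ ‖u‖₃^q < ∞`
  (frame solutions, `q ≥ 0`), and `jawClause_iff_forall_window` (↔ every final window `T₂ ∈ (0,T)` is
  finite);
* **`l3CascadeJaw_iff_whole_interval`** — `L3CascadeJaw ↔ ∀ q ∈ (4,5)`, every frame solution has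
  `∫₀ᵀ ‖u(t)‖₃^q dt < ∞` (no window quantifier);
* **`l3CascadeJaw_iff_unit_whole`** — with the normal form (p454558): `L3CascadeJaw ↔` every
  unit-viscosity frame solution on `[0,1)` has `∫₀¹ ‖u(t)‖₃^q dt < ∞` for every `q ∈ (4,5)` — the crux
  with NO parameters left but `q`.

WHAT THIS IS NOT: not a claim about Navier–Stokes regularity or blow-up; a kernel-checked simplification of
the crux AS TYPED, landed `--supports … --as helper`.
-/

noncomputable section

namespace Summit.NavierStokesRegularity.NavierStokesRegularity.Theorems.L3TimeExponentPincerJawWholeInterval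

open MeasureTheory Set Function Filter Topology
open scoped ENNReal NNReal
open Literature.Analysis.FluidPDE
open Summit.NavierStokesRegularity.NavierStokesRegularity.Theses.L3TimeExponentPincer (L3CascadeJaw)
open Summit.NavierStokesRegularity.NavierStokesRegularity.Theorems.L3TimeExponentPincerSmoothBranch
  (eLpNorm_three_rpow_three_le_of_forall_le)
open Summit.NavierStokesRegularity.NavierStokesRegularity.Theorems.L3TimeExponentPincerJawNormalForm
  (l3CascadeJaw_iff_unit)

/-! ## The integrand is bounded away from `T` -/

/-- **`∫_{(0,T₁]} ‖u(t)‖₃^q dt < ∞` for every `T₁ < T`** (`q ≥ 0`), for a frame solution: on the closed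
slab `[0,T₁]` the velocity is bounded, `|u| ≤ M` (Tao 2013, `exists_forall_norm_le_of_tao2011`), so
`‖u(t)‖₃³ ≤ M · ∫|u(t)|² ≤ M · 2E(u₀)` and the integrand is bounded on a window of finite length.
[cite: Tao2011, Cor. 11.1 + Cor. 4.3 + Thm. 5.4 (iv)] -/
theorem lintegral_l3_rpow_Ioc_lt_top_of_frame {ν T : ℝ} (hν : 0 < ν)
    {u : ℝ → EuclideanSpace ℝ (Fin 3) → EuclideanSpace ℝ (Fin 3)} {p : ℝ → EuclideanSpace ℝ (Fin 3) → ℝ}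
    (hcl : IsClassicalNSSolutionOn (Ico 0 T) ν 0 u p) (hLH : IsLerayHopfOn T ν 0 (u 0) u)
    (hdec : HasRapidSpatialDecay (u 0)) {T₁ : ℝ} (hT₁ : T₁ < T) {q : ℝ} (hq : 0 ≤ q) :
    (∫⁻ t in Ioc 0 T₁, eLpNorm (u t) 3 volume ^ q) < ⊤ := by
  rcases le_or_gt T₁ 0 with hT₁0 | hT₁0
  · rw [Ioc_eq_empty (not_lt.2 hT₁0), Measure.restrict_empty, lintegral_zero_measure]
    exact ENNReal.zero_lt_top
  obtain ⟨M, hM⟩ := exists_forall_norm_le_of_tao2011 tao2011_hasBoundedSobolevNormsOn_holds hν hcl hLH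
    hdec T₁ ⟨hT₁0, hT₁⟩
  set E₀ : ℝ≥0∞ := ENNReal.ofReal (2 * VectorCalculus.kineticEnergy (u 0)) with hE₀
  -- `‖u(t)‖₃³ ≤ M · 2E(u₀)` on `[0, T₁]`
  have h3 : ∀ t ∈ Icc 0 T₁, eLpNorm (u t) 3 volume ^ (3 : ℝ) ≤ ENNReal.ofReal M * E₀ := by
    intro t ht
    have h1 := eLpNorm_three_rpow_three_le_of_forall_le (hM t ht)
    exact h1.trans (mul_le_mul' le_rfl (hLH.lintegral_enorm_sq_le hν.le ⟨ht.1, ht.2.trans hT₁.le⟩))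
  -- hence `‖u(t)‖₃^q ≤ (M · 2E)^{q/3}`
  have hq' : ∀ t ∈ Ioc 0 T₁, eLpNorm (u t) 3 volume ^ q ≤ (ENNReal.ofReal M * E₀) ^ (q / 3) := by
    intro t ht
    have h := ENNReal.rpow_le_rpow (h3 t ⟨ht.1.le, ht.2⟩) (show 0 ≤ q / 3 by positivity)
    rw [← ENNReal.rpow_mul, show (3 : ℝ) * (q / 3) = q by ring] at h
    exact h
  refine lt_of_le_of_lt (setLIntegral_mono' measurableSet_Ioc fun t ht => hq' t ht) ?_
  rw [setLIntegral_const, Real.volume_Ioc]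
  refine ENNReal.mul_lt_top (ENNReal.rpow_lt_top_of_nonneg (by positivity) ?_) ENNReal.ofReal_lt_top
  exact ENNReal.mul_ne_top ENNReal.ofReal_ne_top ENNReal.ofReal_ne_top

/-- **A finite final window gives the whole interval**: `∫_{T₂}^T ‖u‖₃^q < ∞` with `T₂ < T` implies
`∫₀ᵀ ‖u(t)‖₃^q dt < ∞` (`q ≥ 0`, frame solution; split `(0,T) ⊆ (0,T₂] ∪ (T₂,T)`). [folklore] -/
theorem lintegral_whole_lt_top_of_window {ν T : ℝ} (hν : 0 < ν)
    {u : ℝ → EuclideanSpace ℝ (Fin 3) → EuclideanSpace ℝ (Fin 3)} {p : ℝ → EuclideanSpace ℝ (Fin 3) → ℝ}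
    (hcl : IsClassicalNSSolutionOn (Ico 0 T) ν 0 u p) (hLH : IsLerayHopfOn T ν 0 (u 0) u)
    (hdec : HasRapidSpatialDecay (u 0)) {q : ℝ} (hq : 0 ≤ q) {T₂ : ℝ} (hT₂ : T₂ < T)
    (hfin : (∫⁻ t in Ioo T₂ T, eLpNorm (u t) 3 volume ^ q) < ⊤) :
    (∫⁻ t in Ioo 0 T, eLpNorm (u t) 3 volume ^ q) < ⊤ := by
  have hsub : Ioo 0 T ⊆ Ioc 0 T₂ ∪ Ioo T₂ T := by
    intro t ht
    rcases le_or_gt t T₂ with h | h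
    · exact Or.inl ⟨ht.1, h⟩
    · exact Or.inr ⟨h, ht.2⟩
  refine lt_of_le_of_lt (lintegral_mono_set hsub) ?_
  refine lt_of_le_of_lt (lintegral_union_le _ _ _) (ENNReal.add_lt_top.2 ⟨?_, hfin⟩)
  exact lintegral_l3_rpow_Ioc_lt_top_of_frame hν hcl hLH hdec hT₂ hq

/-- **The window is decoration**: for a frame solution and `q ≥ 0`,
`(∃ T₂ ∈ (0,T), ∫_{T₂}^T ‖u‖₃^q < ∞) ↔ ∫₀ᵀ ‖u(t)‖₃^q dt < ∞`. [folklore] -/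
theorem jawClause_iff_whole_interval {ν T : ℝ} (hν : 0 < ν) (hT : 0 < T)
    {u : ℝ → EuclideanSpace ℝ (Fin 3) → EuclideanSpace ℝ (Fin 3)} {p : ℝ → EuclideanSpace ℝ (Fin 3) → ℝ}
    (hcl : IsClassicalNSSolutionOn (Ico 0 T) ν 0 u p) (hLH : IsLerayHopfOn T ν 0 (u 0) u)
    (hdec : HasRapidSpatialDecay (u 0)) {q : ℝ} (hq : 0 ≤ q) :
    (∃ T₂ ∈ Ioo 0 T, (∫⁻ t in Ioo T₂ T, eLpNorm (u t) 3 volume ^ q) < ⊤) ↔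
      (∫⁻ t in Ioo 0 T, eLpNorm (u t) 3 volume ^ q) < ⊤ := by
  constructor
  · rintro ⟨T₂, hT₂, hfin⟩
    exact lintegral_whole_lt_top_of_window hν hcl hLH hdec hq hT₂.2 hfin
  · intro h
    refine ⟨T / 2, ⟨by linarith, by linarith⟩, ?_⟩
    exact lt_of_le_of_lt (lintegral_mono_set (Ioo_subset_Ioo_left (by linarith))) h

/-- **Every final window is as good as one**: for a frame solution and `q ≥ 0`, a finite final window exists
iff EVERY final window `(T₂,T)`, `T₂ ∈ (0,T)`, is finite (windows starting at negative times are excluded: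
the frame constrains `u` only on `[0,T]`). [folklore] -/
theorem jawClause_iff_forall_window {ν T : ℝ} (hν : 0 < ν) (hT : 0 < T)
    {u : ℝ → EuclideanSpace ℝ (Fin 3) → EuclideanSpace ℝ (Fin 3)} {p : ℝ → EuclideanSpace ℝ (Fin 3) → ℝ}
    (hcl : IsClassicalNSSolutionOn (Ico 0 T) ν 0 u p) (hLH : IsLerayHopfOn T ν 0 (u 0) u)
    (hdec : HasRapidSpatialDecay (u 0)) {q : ℝ} (hq : 0 ≤ q) :
    (∃ T₂ ∈ Ioo 0 T, (∫⁻ t in Ioo T₂ T, eLpNorm (u t) 3 volume ^ q) < ⊤) ↔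
      ∀ T₂ ∈ Ioo 0 T, (∫⁻ t in Ioo T₂ T, eLpNorm (u t) 3 volume ^ q) < ⊤ := by
  rw [jawClause_iff_whole_interval hν hT hcl hLH hdec hq]
  constructor
  · intro h T₂ hT₂
    exact lt_of_le_of_lt (lintegral_mono_set (Ioo_subset_Ioo_left hT₂.1.le)) h
  · intro h
    have h2 := h (T / 2) ⟨by linarith, by linarith⟩
    exact lintegral_whole_lt_top_of_window hν hcl hLH hdec hq (by linarith : T / 2 < T) h2

/-! ## The crux without the window quantifier -/

/-- **`L3CascadeJaw` ↔ whole-interval integrability**: for every `q ∈ (4,5)`, every frame solution has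
`∫₀ᵀ ‖u(t)‖₃^q dt < ∞` — the final window `∃ T₂` of the crux's text is decoration. [folklore] -/
theorem l3CascadeJaw_iff_whole_interval :
    L3CascadeJaw ↔
      ∀ q : ℝ, 4 < q → q < 5 → ∀ (ν T : ℝ), 0 < ν → 0 < T →
        ∀ (u : ℝ → EuclideanSpace ℝ (Fin 3) → EuclideanSpace ℝ (Fin 3)) (p : ℝ → EuclideanSpace ℝ (Fin 3) → ℝ),
          IsClassicalNSSolutionOn (Ico 0 T) ν 0 u p → IsLerayHopfOn T ν 0 (u 0) u →
          HasRapidSpatialDecay (u 0) →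
          (∫⁻ t in Ioo 0 T, eLpNorm (u t) 3 volume ^ q) < ⊤ := by
  constructor
  · intro hJ q hq4 hq5 ν T hν hT u p hcl hLH hdec
    exact (jawClause_iff_whole_interval hν hT hcl hLH hdec (by linarith)).1
      (hJ q hq4 hq5 ν T hν hT u p hcl hLH hdec)
  · intro h q hq4 hq5 ν T hν hT u p hcl hLH hdec
    exact (jawClause_iff_whole_interval hν hT hcl hLH hdec (by linarith)).2
      (h q hq4 hq5 ν T hν hT u p hcl hLH hdec)

/-- **The crux with no parameter left but `q`**: `L3CascadeJaw ↔` for every `q ∈ (4,5)`, every classical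
unit-viscosity solution on `ℝ³ × [0,1)` that is Leray–Hopf from a rapidly decaying datum has
`∫₀¹ ‖u(t)‖₃^q dt < ∞` (normal form `l3CascadeJaw_iff_unit`, p454558, plus the window lemma). [folklore] -/
theorem l3CascadeJaw_iff_unit_whole :
    L3CascadeJaw ↔
      ∀ q : ℝ, 4 < q → q < 5 →
        ∀ (u : ℝ → EuclideanSpace ℝ (Fin 3) → EuclideanSpace ℝ (Fin 3)) (p : ℝ → EuclideanSpace ℝ (Fin 3) → ℝ),
          IsClassicalNSSolutionOn (Ico 0 1) 1 0 u p → IsLerayHopfOn 1 1 0 (u 0) u →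
          HasRapidSpatialDecay (u 0) →
          (∫⁻ t in Ioo 0 1, eLpNorm (u t) 3 volume ^ q) < ⊤ := by
  rw [l3CascadeJaw_iff_unit]
  constructor
  · intro h q hq4 hq5 u p hcl hLH hdec
    exact (jawClause_iff_whole_interval one_pos one_pos hcl hLH hdec (by linarith)).1
      (h q hq4 hq5 u p hcl hLH hdec)
  · intro h q hq4 hq5 u p hcl hLH hdec
    exact (jawClause_iff_whole_interval one_pos one_pos hcl hLH hdec (by linarith)).2
      (h q hq4 hq5 u p hcl hLH hdec)

end Summit.NavierStokesRegularity.NavierStokesRegularity.Theorems.L3TimeExponentPincerJawWholeInterval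

end
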